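import Mathlib.NumberTheory.NumberField.CMField
import Mathlib.NumberTheory.NumberField.Norm
import Mathlib.RingTheory.Ideal.Norm.AbsNorm
import Mathlib.RingTheory.DedekindDomain.AdicValuation
import HarnessLib

/-!
# Complex conjugation on `𝒪_K` for a CM / imaginary quadratic field: the involution `σ`, the norm form `N((a)) = a·σa`, and the
# conjugate prime `v̄` — the inputs `σ, hσσ, hnorm, v', hσv'` of `…EllipticUnitsLocalDivisionTwists.exists_divisionTwists`

Cell `bsd-print-cf2`, width seat `bsd-line-cf2c-w4` g10; `--supports` stmt-BirchSwinnertonDyer-24721 (helper, Theses-free). THEOREMS ONLY;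
no definitions (the involution is the TERM `NumberField.RingOfIntegers.mapRingEquiv (NumberField.IsCMField.complexConj K).toRingEquiv`), no
named facts.

`exists_divisionTwists` (p750420) produces de Shalit's division twists `𝔞₁ = (α₁)`, `𝔞₂ = 𝔞̄₁` from: an involution `σ` of `𝒪_K`, a prime
`v' ≠ v` with `σ(v') ⊆ v`, and the norm form `((N(a)) : 𝒪_K) = a·σa`.  For `K` imaginary quadratic (the CM field of the curve) these are
complex conjugation, `v̄`, and `N_{K/ℚ}(a) = a ā > 0`; THIS file supplies them from Mathlib's `NumberField.IsCMField.complexConj`: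

* §1 `algebraMap_norm_eq_mul_complexConj` (`[K:ℚ] = 2`: `N_{K/ℚ}(x) = x·x̄`, `Algebra.norm_eq_prod_automorphisms` with `Aut(K/ℚ) = {1, conj}`),
  `norm_nonneg_of_finrank_eq_two` (`φ(x x̄) = |φx|²`), ★ `natCast_absNorm_span_singleton_eq_mul_conj` — **`((N((a)) : ℕ) : 𝒪_K) = a · σa`**
  for `σ = conj|_{𝒪_K}` (the `hnorm` of `exists_divisionTwists`), `mapRingEquiv_complexConj_apply_apply` (`σσ = 1`, the `hσσ`);
* §2 `exists_heightOneSpectrum_forall_mem_iff` — **the conjugate prime `v̄ = σ⁻¹(v)`** of any `v` under any automorphism `σ` of `𝒪_K`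
  (`y ∈ v̄ ↔ σy ∈ v`, so `hσv'` holds by construction; `v̄ ≠ v` iff `v` is not `σ`-stable — for `v ∣ 2` split this is the user's
  «`2 = v v̄`, `v ≠ v̄`»).

HONEST FRAMING: elementary; nothing here closes a crux; no summit statement is proved; BSD is not proved by any of this.

## References
* [deShalit1987] E. de Shalit, *Iwasawa theory of elliptic curves with complex multiplication* (1987), II.4.12 (p. 66–68) (`𝔞₂ = 𝔞̄₁`).
* [NeukirchANT1999] J. Neukirch, *Algebraic Number Theory* (1999), Ch. I §2 (norm), §3 (3.1).
-/

-- the summit namespace `Summit.BirchSwinnertonDyer.BirchSwinnertonDyer` repeats the problem name by design (D-0017)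
set_option linter.dupNamespace false
set_option autoImplicit false

noncomputable section

open scoped Classical NumberField ComplexConjugate
open NumberField NumberField.IsCMField IsDedekindDomain

namespace Summit.BirchSwinnertonDyer.BirchSwinnertonDyer.Theorems.PrintCf2.EllipticUnitsLocal

variable {K : Type} [Field K] [NumberField K]

/-! ## §1. `N_{K/ℚ}(x) = x·x̄ ≥ 0` and `N((a)) = a·σa` in `𝒪_K` -/

section Norm

variable [IsCMField K]

/-- **`N_{K/ℚ}(x) = x · x̄`** for `[K : ℚ] = 2` (`Aut(K/ℚ) = {1, conj}`, `Algebra.norm_eq_prod_automorphisms`).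
[cite: NeukirchANT1999, Ch. I §2 (2.6)] -/
theorem algebraMap_norm_eq_mul_complexConj (h2 : Module.finrank ℚ K = 2) (x : K) :
    algebraMap ℚ K (Algebra.norm ℚ x) = x * complexConj K x := by
  haveI : Algebra.IsQuadraticExtension ℚ K := ⟨h2⟩
  let σ : K ≃ₐ[ℚ] K := AlgEquiv.ofRingEquiv (f := (complexConj K).toRingEquiv) (fun q ↦ by
    rw [eq_ratCast, map_ratCast])
  have hσx : ∀ y : K, σ y = complexConj K y := fun _ ↦ rfl
  have hσ1 : σ ≠ 1 := by
    intro h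
    apply complexConj_ne_one K
    ext y
    rw [← hσx, h]; rfl
  have hcard : Fintype.card (K ≃ₐ[ℚ] K) = 2 := by
    rw [Fintype.card_eq_nat_card, IsGalois.card_aut_eq_finrank, h2]
  have huniv : (Finset.univ : Finset (K ≃ₐ[ℚ] K)) = {1, σ} := by
    symm
    apply Finset.eq_of_subset_of_card_le (Finset.subset_univ _)
    rw [Finset.card_univ, hcard, Finset.card_pair (Ne.symm hσ1)]
  rw [Algebra.norm_eq_prod_automorphisms ℚ x, huniv, Finset.prod_pair (Ne.symm hσ1), AlgEquiv.one_apply, hσx]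

/-- **`N_{K/ℚ}(x) ≥ 0`** for `[K : ℚ] = 2`, `K` CM (`φ(x x̄) = |φ x|²` for any complex embedding `φ`). [cite: NeukirchANT1999, Ch. I §2] -/
theorem norm_nonneg_of_finrank_eq_two (h2 : Module.finrank ℚ K = 2) (x : K) : 0 ≤ Algebra.norm ℚ x := by
  set φ : K →+* ℂ := Classical.choice (inferInstance : Nonempty (K →+* ℂ)) with hφ
  have h1 : φ (algebraMap ℚ K (Algebra.norm ℚ x)) = ((Algebra.norm ℚ x : ℚ) : ℂ) := by
    rw [eq_ratCast, map_ratCast]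
  have h2' : φ (algebraMap ℚ K (Algebra.norm ℚ x)) = (Complex.normSq (φ x) : ℂ) := by
    rw [algebraMap_norm_eq_mul_complexConj h2, map_mul, complexEmbedding_complexConj, Complex.mul_conj]
  have h3 : ((Algebra.norm ℚ x : ℚ) : ℝ) = Complex.normSq (φ x) := by exact_mod_cast h1.symm.trans h2'
  have h4 : (0 : ℝ) ≤ ((Algebra.norm ℚ x : ℚ) : ℝ) := h3 ▸ Complex.normSq_nonneg _
  exact_mod_cast h4

/-- `(σ a : K) = conj (a : K)` for `σ = conj|_{𝒪_K}`. [folklore] -/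
theorem coe_mapRingEquiv_complexConj (a : 𝓞 K) :
    ((RingOfIntegers.mapRingEquiv (complexConj K).toRingEquiv a : 𝓞 K) : K) = complexConj K (a : K) := by
  rw [RingOfIntegers.mapRingEquiv_apply]; rfl

/-- `σ (σ a) = a` for `σ = conj|_{𝒪_K}` (the `hσσ` of `exists_divisionTwists`). [folklore] -/
theorem mapRingEquiv_complexConj_apply_apply (a : 𝓞 K) :
    RingOfIntegers.mapRingEquiv (complexConj K).toRingEquiv (RingOfIntegers.mapRingEquiv (complexConj K).toRingEquiv a) = a := by
  apply RingOfIntegers.ext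
  rw [coe_mapRingEquiv_complexConj, coe_mapRingEquiv_complexConj, complexConj_apply_apply]

/-- ★ **`((N((a)) : ℕ) : 𝒪_K) = a · σa`** for `σ = conj|_{𝒪_K}`, `[K : ℚ] = 2` (`N((a)) = |N_{K/ℚ}(a)| = N_{K/ℚ}(a) = a ā`) — the
norm form `hnorm` of `exists_divisionTwists` (de Shalit's `N𝔞₁ = N𝔞̄₁ = α₁ ᾱ₁`). [cite: deShalit1987, II.4.12 (p. 67)] [cite: NeukirchANT1999, Ch. I §2 (2.6)] -/
theorem natCast_absNorm_span_singleton_eq_mul_conj (h2 : Module.finrank ℚ K = 2) (a : 𝓞 K) :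
    ((Ideal.absNorm (Ideal.span {a}) : ℕ) : 𝓞 K) = a * RingOfIntegers.mapRingEquiv (complexConj K).toRingEquiv a := by
  apply RingOfIntegers.ext
  have hn : 0 ≤ Algebra.norm ℤ a := by
    have h := norm_nonneg_of_finrank_eq_two h2 (a : K)
    rw [← Algebra.coe_norm_int a] at h
    exact_mod_cast h
  obtain ⟨m, hm⟩ := Int.eq_ofNat_of_zero_le hn
  have habs : (Algebra.norm ℤ a).natAbs = m := by rw [hm, Int.natAbs_natCast]
  have hK : algebraMap ℚ K (Algebra.norm ℚ (a : K)) = (m : K) := by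
    rw [← Algebra.coe_norm_int a, hm, eq_ratCast]; push_cast; rfl
  rw [NumberField.RingOfIntegers.coe_eq_algebraMap, NumberField.RingOfIntegers.coe_eq_algebraMap, map_natCast, map_mul,
    ← NumberField.RingOfIntegers.coe_eq_algebraMap, ← NumberField.RingOfIntegers.coe_eq_algebraMap,
    coe_mapRingEquiv_complexConj, ← algebraMap_norm_eq_mul_complexConj h2, hK, Ideal.absNorm_span_singleton, habs]

end Norm

/-! ## §2. The conjugate prime `v̄ = σ⁻¹(v)` -/

omit [NumberField K] in
/-- **The conjugate prime**: for an automorphism `σ` of `𝒪_K` and a prime `v`, the prime `v̄ := σ⁻¹(v)` with `y ∈ v̄ ↔ σ y ∈ v`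
(so `σ(v̄) ⊆ v` — the `hσv'` of `exists_divisionTwists` — holds by construction; `v̄ ≠ v` iff `v` is not `σ`-stable).
[cite: NeukirchANT1999, Ch. I §3 (3.1)] -/
theorem exists_heightOneSpectrum_forall_mem_iff (σ : 𝓞 K ≃+* 𝓞 K) (v : HeightOneSpectrum (𝓞 K)) :
    ∃ v' : HeightOneSpectrum (𝓞 K), ∀ y : 𝓞 K, y ∈ v'.asIdeal ↔ σ y ∈ v.asIdeal := by
  refine ⟨⟨v.asIdeal.comap (σ : 𝓞 K →+* 𝓞 K), Ideal.IsPrime.comap _, fun h ↦ v.ne_bot ?_⟩, fun y ↦ Ideal.mem_comap⟩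
  refine (Submodule.eq_bot_iff _).mpr fun x hx ↦ ?_
  have hx' : σ.symm x ∈ v.asIdeal.comap (σ : 𝓞 K →+* 𝓞 K) := by
    rw [Ideal.mem_comap, RingHom.coe_coe, RingEquiv.apply_symm_apply]; exact hx
  rw [h, Ideal.mem_bot] at hx'
  simpa using congrArg σ hx'

end Summit.BirchSwinnertonDyer.BirchSwinnertonDyer.Theorems.PrintCf2.EllipticUnitsLocal

end
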